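import Literature.NumberTheory.LFunctions.ZetaArgumentCertificate
import HarnessLib

/-!
# The first zero of `ζ`: `N(14) = 0`, `N(16) = 1`, and `14 < γ₀ ≤ 227/16 < 16 < γ₁`

Trunk T-ANT (`NumberTheory/LFunctions`) with T-VALNUM. A second accepted certificate for the
kernel-checked Backlund format of `ZetaArgumentCertificate.lean` (`Literature.NumberTheory.LFunctions.ZetaCert.RHCert`),
this time at height `T = 14` with **no** brackets, and the consequences for the counting
function `N(T) = Literature.zetaZeroCount T` and the ordinates `γ_n = Literature.zetaOrdinate n`:

* `RHCert.zetaZeroCount_eq_length`, `RHCert.criticalZeroCount_eq_length` — an accepted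
  certificate determines the counts exactly: `N(T) = N₀(T) = #brackets` (the first half of
  `RHCert.sound`, recorded as a statement of its own).
* `RH14.theCert`, `RH14.theCert_check` — the certificate for `T = 14`: five pieces of the top
  edge `[½, 2] × {14}` with labels `3, 3, 0, 0, 0` (`Im ζ < 0` on `[½, ¾]`, `Re ζ > 0` on
  `[¾, 2]`; one signed quarter turn), empty bracket list, the logarithm table of `RH16`
  (`K = 20`); accepted by `decide +kernel` in a few seconds.
* `zetaZeroCount_fourteen : N(14) = 0`, `criticalZeroCount_fourteen : N₀(14) = 0`,
  `zetaZeroCount_sixteen : N(16) = 1`, `criticalZeroCount_sixteen : N₀(16) = 1`.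
* `riemannZeta_ne_zero_of_im_pos_of_im_le_fourteen` — `ζ(s) ≠ 0` for `0 < Im s ≤ 14`.
* `fourteen_lt_zetaOrdinate_zero_holds : 14 < γ₀` — **discharge** of the named fact
  `Literature.NumberTheory.LFunctions.fourteen_lt_zetaOrdinate_zero` of `ZetaZeros.lean` (consumed by `ZeroGaps.lean`).
* `zetaOrdinate_zero_le : γ₀ ≤ 227/16` (the bracket of `RH16.theCert` around
  `γ₀ = 14.1347…`) and `sixteen_lt_zetaOrdinate_one : 16 < γ₁`: the first zero is simple and it
  is the only zero of `ζ` with `0 < Im ρ ≤ 16`.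

The planner for `RH14.theTop` (cut-offs, labels, abscissae `½, ⅝, ¾, 35/32, 59/32, 2`) ran in
floating point outside Lean; only the kernel's verdict `RH14.theCert_check` is used.

## References

* H. M. Edwards, *Riemann's Zeta Function*, Academic Press 1974, §6.6 (Backlund's
  determination of `N(T)`). [Edwards1974]
* J.-P. Gram, *Note sur les zéros de la fonction ζ(s) de Riemann*, Acta Math. 27 (1903),
  289–304 (`γ₁ = 14.1347…`). [Gram1903]
* E. C. Titchmarsh, *The Theory of the Riemann Zeta-Function*, 2nd ed. 1986, §9.1, §15.2.
  [Titchmarsh1986]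
-/

noncomputable section

open Literature.Analysis.Complex Complex Set

namespace Literature.NumberTheory.LFunctions.ZetaCert

namespace RHCert

/-- **An accepted certificate determines `N(T)`**: `N(T) = #brackets` (the top edge gives
`N(T) = n` for the `n` of the Stirling check, which the checker runs with `n = #brackets`).
[cite: Edwards1974, §6.6] -/
theorem zetaZeroCount_eq_length {C : RHCert} (h : C.check = true) :
    zetaZeroCount (C.T : ℝ) = C.brackets.length := by
  unfold check at h
  split at h
  · exact absurd h Bool.false_ne_true
  · rename_i P L hPL
    simp only [Bool.and_eq_true, decide_eq_true_eq] at h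
    obtain ⟨⟨⟨⟨⟨⟨⟨⟨⟨hT2, -⟩, hK3⟩, hlogs⟩, hall⟩, hchain⟩, hlast⟩, hdir⟩, -⟩, hst⟩ := h
    have hl := logsValid_of_check hlogs
    have hT0 : (0 : ℚ) < C.T := by linarith
    have hall' : ∀ Q ∈ P :: L, Q.check C.logs C.K = true := by
      intro Q hQ; exact List.all_eq_true.1 hall Q hQ
    have hH := hpieces_realize hl (P :: L) (1 / 2) hall' hchain
    rw [realize] at hH
    have hH' : HPieces riemannZeta ((C.T : ℚ) : ℝ) (1 / 2)
        ((((P.b.σ : ℚ) : ℝ), P.d) :: realize L) := by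
      convert hH using 2; norm_num
    have hlast' : piecesLast ((P.b.σ : ℚ) : ℝ) (realize L) = 2 := by
      rw [piecesLast_realize, hlast]; norm_num
    have hdir' : piecesLastDir P.d (realize L) = 0 := by rw [piecesLastDir_realize, hdir]
    have hV := stirling_of_check hl hK3 hT0 hst
    rw [← piecesTurns_realize] at hV
    exact MertensZeroCertificate.zetaZeroCount_eq_of_hpieces_stirling (by exact_mod_cast hT2) hH' hlast' hdir' hV

/-- **An accepted certificate determines `N₀(T)`** as well: `N₀(T) = #brackets`
(`#brackets ≤ N₀(T) ≤ N(T) = #brackets`). [cite: Edwards1974, §6.6] -/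
theorem criticalZeroCount_eq_length {C : RHCert} (h : C.check = true) :
    criticalZeroCount (C.T : ℝ) = C.brackets.length := by
  have hN := zetaZeroCount_eq_length h
  have hle := DiophantineGeometry.criticalZeroCount_le (C.T : ℝ)
  unfold check at h
  split at h
  · exact absurd h Bool.false_ne_true
  · rename_i P L hPL
    simp only [Bool.and_eq_true, decide_eq_true_eq] at h
    obtain ⟨⟨⟨⟨⟨⟨⟨⟨⟨-, hT20⟩, -⟩, hlogs⟩, -⟩, -⟩, -⟩, -⟩, hbr⟩, -⟩ := h
    have hl := logsValid_of_check hlogs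
    have hT20' : ((C.T : ℚ) : ℝ) ≤ 2 ^ 20 := by exact_mod_cast hT20
    have hN0 := criticalZeroCount_add_length_le hl hT20' C.brackets 0 le_rfl hbr
    push_cast at hN0
    omega

end RHCert

/-! ## The certificate for `T = 14` -/

namespace RH14

/-- Pieces of the top edge `½ + 14i → 2 + 14i`: labels `3, 3` (`Re(iζ) > 0`, i.e. `Im ζ < 0`)
on `[½, ⅝]`, `[⅝, ¾]`, then `0` (`Re ζ > 0`) on `[¾, 35/32]`, `[35/32, 59/32]`, `[59/32, 2]`;
all nodes with cut-off `N = 20`. [folklore] -/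
def theTop : List Piece :=
  [⟨⟨((1 : ℚ) / 2), (14 : ℚ), 20, ((897 : ℚ) / 64)⟩,
      ⟨((5 : ℚ) / 8), (14 : ℚ), 20, ((897 : ℚ) / 64)⟩, 3, 4, ((897 : ℚ) / 64), (14 : ℚ)⟩,
   ⟨⟨((5 : ℚ) / 8), (14 : ℚ), 20, ((897 : ℚ) / 64)⟩,
      ⟨((3 : ℚ) / 4), (14 : ℚ), 20, ((449 : ℚ) / 32)⟩, 3, 4, ((449 : ℚ) / 32), (14 : ℚ)⟩,
   ⟨⟨((3 : ℚ) / 4), (14 : ℚ), 20, ((449 : ℚ) / 32)⟩,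
      ⟨((35 : ℚ) / 32), (14 : ℚ), 20, ((899 : ℚ) / 64)⟩, 0, 4, ((899 : ℚ) / 64), (14 : ℚ)⟩,
   ⟨⟨((35 : ℚ) / 32), (14 : ℚ), 20, ((899 : ℚ) / 64)⟩,
      ⟨((59 : ℚ) / 32), (14 : ℚ), 20, ((113 : ℚ) / 8)⟩, 0, 4, ((113 : ℚ) / 8), (14 : ℚ)⟩,
   ⟨⟨((59 : ℚ) / 32), (14 : ℚ), 20, ((113 : ℚ) / 8)⟩,
      ⟨(2 : ℚ), (14 : ℚ), 20, ((453 : ℚ) / 32)⟩, 0, 2, ((453 : ℚ) / 32), (14 : ℚ)⟩]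

/-- **The certificate for `T = 14`**: the table of `RH16` (`K = 20`), the five pieces, no
brackets, exponent `j = 4` (`14/2⁴ = 7/8 ∈ [½, 1]`). [folklore] -/
def theCert : RHCert := ⟨14, RH16.theLogs, theTop, [], 4⟩

/-- **The checker accepts the certificate** (kernel evaluation, a few seconds). [folklore] -/
theorem theCert_check : theCert.check = true := by
  decide +kernel

end RH14

end Literature.NumberTheory.LFunctions.ZetaCert

namespace Literature.NumberTheory.LFunctions

open ZetaCert

/-- **`N(14) = 0`**: `ζ` has no zeros `ρ` with `0 < Im ρ ≤ 14` (counted with multiplicity).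
[cite: Edwards1974, §6.6] -/
theorem zetaZeroCount_fourteen : zetaZeroCount 14 = 0 := by
  have h := RHCert.zetaZeroCount_eq_length RH14.theCert_check
  norm_num [RH14.theCert] at h
  exact h

/-- `N₀(14) = 0`. [cite: Edwards1974, §6.6] -/
theorem criticalZeroCount_fourteen : criticalZeroCount 14 = 0 := by
  have h := (DiophantineGeometry.criticalZeroCount_le 14).trans_eq zetaZeroCount_fourteen
  omega

/-- **`N(16) = 1`** (from the accepted certificate `RH16.theCert` of
`ZetaArgumentCertificate.lean`). [cite: Edwards1974, §6.6] -/
theorem zetaZeroCount_sixteen : zetaZeroCount 16 = 1 := by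
  have h := RHCert.zetaZeroCount_eq_length RH16.theCert_check
  norm_num [RH16.theCert, RH16.theBrackets] at h
  exact h

/-- `N₀(16) = 1`. [cite: Edwards1974, §6.6] -/
theorem criticalZeroCount_sixteen : criticalZeroCount 16 = 1 := by
  have h := RHCert.criticalZeroCount_eq_length RH16.theCert_check
  norm_num [RH16.theCert, RH16.theBrackets] at h
  exact h

/-- A zero `s` of `ζ` with `0 < Im s ≤ T` forces `1 ≤ N(T)`. [folklore] -/
theorem one_le_zetaZeroCount_of_zero {s : ℂ} {T : ℝ} (hs : riemannZeta s = 0) (h0 : 0 < s.im)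
    (hT : s.im ≤ T) : 1 ≤ zetaZeroCount T := by
  classical
  have hmem : s ∈ zetaZeroBox 0 T := DiophantineGeometry.mem_zetaZeroBox_of_riemannZeta_eq_zero hs h0 hT
  have hfin := zetaZeroBox_finite 0 T
  have key := finsum_riemannZetaZeroOrder_add_card_le (A := ∅) hfin (Set.empty_subset _)
    (fun ρ hρ ↦ DiophantineGeometry.riemannZetaZeroOrder_pos_of_mem_zetaZeroBox hρ) {s} (by simpa using hmem)
  simp only [finsum_mem_empty, Finset.card_singleton, Nat.cast_one, zero_add] at key
  unfold zetaZeroCount zetaZeroCountRe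
  omega

/-- **No zeros of `ζ` with `0 < Im s ≤ 14`.** [cite: Edwards1974, §6.6] -/
theorem riemannZeta_ne_zero_of_im_pos_of_im_le_fourteen {s : ℂ} (h0 : 0 < s.im)
    (h14 : s.im ≤ 14) : riemannZeta s ≠ 0 := by
  intro hs
  have := one_le_zetaZeroCount_of_zero hs h0 h14
  rw [zetaZeroCount_fourteen] at this
  exact Nat.not_succ_le_zero 0 this

/-- **`14 < γ₀`** — discharge of the named fact `Literature.NumberTheory.LFunctions.fourteen_lt_zetaOrdinate_zero`
(`ZetaZeros.lean`): `γ₀ ≤ 14 ↔ 1 ≤ N(14)` (`riemann_von_mangoldt.zetaOrdinate_le_iff`, with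
R–vM proved in `ZetaArgVariation.lean`) and `N(14) = 0`. [cite: Gram1903] -/
theorem fourteen_lt_zetaOrdinate_zero_holds : fourteen_lt_zetaOrdinate_zero := by
  unfold fourteen_lt_zetaOrdinate_zero
  by_contra h
  rw [not_lt] at h
  have := riemann_von_mangoldt_holds.zetaOrdinate_le_iff.1 h
  rw [zetaZeroCount_fourteen] at this
  exact Nat.not_succ_le_zero 0 this

/-- The bracket of `RH16.theCert`: `ζ(½ + iγ) = 0` for some `γ ∈ [225/16, 227/16]`.
[cite: Edwards1974, §6.6] -/
theorem exists_zero_Icc_first_bracket :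
    ∃ γ ∈ Icc (225 / 16 : ℝ) (227 / 16), riemannZeta (1 / 2 + γ * I) = 0 := by
  have hl : LogsValid RH16.theLogs 20 := logsValid_of_check (by decide +kernel)
  have hB : Bracket.check RH16.theLogs 20
      (⟨((1 : ℚ) / 2), ((225 : ℚ) / 16), 19, ((901 : ℚ) / 64)⟩,
        ⟨((1 : ℚ) / 2), ((227 : ℚ) / 16), 20, ((909 : ℚ) / 64)⟩) = true := by
    decide +kernel
  have h := Bracket.exists_zero hl hB (by norm_num)
  norm_num at h
  obtain ⟨γ, hγ, hz⟩ := h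
  exact ⟨γ, hγ, hz⟩

/-- **`γ₀ ≤ 227/16`** (`= 14.1875`): there is a zero with ordinate in `[225/16, 227/16]`, so
`N(227/16) ≥ 1`. [cite: Gram1903] -/
theorem zetaOrdinate_zero_le : zetaOrdinate 0 ≤ 227 / 16 := by
  obtain ⟨γ, ⟨h1, h2⟩, hz⟩ := exists_zero_Icc_first_bracket
  refine riemann_von_mangoldt_holds.zetaOrdinate_le_iff.2 ?_
  have h := zetaZeroCount_add_card_le (a := 0) (b := 227 / 16) le_rfl (by norm_num) {γ}
    (fun x hx ↦ by
      rw [Finset.mem_singleton] at hx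
      subst hx
      exact ⟨hz, by linarith, h2⟩)
  rw [Finset.card_singleton] at h
  omega

/-- **`16 < γ₁`**: `γ₁ ≤ 16 ↔ 2 ≤ N(16) = 1`. So `ρ₀ = ½ + iγ₀` is a simple zero and the only
zero of `ζ` with `0 < Im ρ ≤ 16`. [cite: Edwards1974, §6.6] -/
theorem sixteen_lt_zetaOrdinate_one : 16 < zetaOrdinate 1 := by
  by_contra h
  rw [not_lt] at h
  have := riemann_von_mangoldt_holds.zetaOrdinate_le_iff.1 h
  rw [zetaZeroCount_sixteen] at this
  omega

end Literature.NumberTheory.LFunctions
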